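import Summits.ABC.ABC.Theses.PadicPrimesKummerThird
import Literature.NumberTheory.Transcendental.Nesterenko2003Prop51Holds
import Summits.ABC.StewartYu.YuOhSevenTransferOdd
import Summits.ABC.StewartYu.GenThreeBaseOdd
import Summits.ABC.StewartYu.PadicG3FrameOdd
import Summits.ABC.StewartYu.PadicG3ParOdd2
import Summits.ABC.StewartYu.PadicG3RecordR3
import Summits.ABC.StewartYu.PadicG3SchedB
import Summits.ABC.StewartYu.PadicG3OrdLine
import Summits.ABC.StewartYu.RecordDatum
import Summits.ABC.ABC.Theorems.PadicPrimesKummerThirdY07OddStubIneqs1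
import Summits.ABC.StewartYu.PadicG3VbPack
import HarnessLib

/-! # CRUX `Y07Odd` (stmt-ABC-19658) OF ROUTE `PadicPrimesKummerThird` — Yu's 2007 `p`-adic bound over `ℚ` for sets of
primes at an ODD prime `p ∉ S`, in the kernel (cell abc-stewartyu, line `gen3-slab-odd`, F-odd lead p2-g4)

Chain: the odd-`p` analytic frame `FrameOdd C p n` for `C m = (2^{100})^m` at every rank `n ≥ 2`
(`G3Setup.frameOdd_of_recordR`, 38 files `PadicG3*` of this seat: pivot + Teichmüller twist + slab pigeonhole + Siegel
START + k-steps / Kummer half-steps along Nesterenko's 2003 level schedule + OUTPUT `FrameOutputTwo`) applied to the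
record supply `RecordSupplyOddR` — itself assembled BY CASES on the slab depth `m` of the parameter record
`parOdd₂` from the record's NAMED INEQUALITIES `IneqPackR₃` (branch `m = 0`: schedule `schedVb b`, p3-g7; branch
`m ≥ 1`: schedule `sched1b b`, p5-g4 / p1-g8), the END sizing (`endSizingVb` / `endSizing1b`), lp-1's datum records
(`recordOddV_datum` / `recordOdd1_datum`) and the `Λ`-order line (`ordLine_of_negBound`) — then Matveev's induction on
the rank with the base ranks (`GenThreeBaseOdd.engineOdd_of_frame_two_le`, p4-g3) at the zero estimate
`Nesterenko2003_prop51_holds` (lp-1/p5), then the transfer `YuOhSeven.y07Odd_of_genThreeEngineOdd` (p2-g3, `c₆ = 3c₁`).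

References: K. Yu, Forum Math. 19 (2007), Main Theorem (`K = ℚ`); K. Yu, Acta Math. 211 (2013) §§3–7;
Yu. V. Nesterenko, LNM 1819 (2003) §§3–5.
-/

namespace Summit.ABC.ABC.Theorems

open Summit.ABC.ABC.Theses.PadicPrimesKummerThird
open Literature.NumberTheory.Transcendental Literature.NumberTheory.Transcendental.GaGm

/-- **The record supply `RecordSupplyOddR ((2^{100})^·) p n`** (every odd prime `p`, every rank `n ≥ 2`), BY CASES on the slab depth
`m` of the R21 parameter record `P := parOdd₂ p … V Vmax W` (`Nq = K`, `Amax = min Vmax (2ⁿ∏V)`, `θ₀ = ½`, `K₀ = p − 1`):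
`m = 0` → the named inequalities `IneqPackR₃ S (P.schedVb 1)` are p3-g7's `G3Setup.ineqPackR₃_schedVb_one` (`PadicG3VbPack`:
k-step lines `kstep_line_Vb`, half-step line `half_line_Vb`, lp-1's START count, the smallness exponent `expLine_V`), then
`endSizingVb` + lp-1's `recordOddV_datum`; `m ≥ 1` → the landed registered stub `SlabOdd.stub_ineqs1` (p5-g4,
`PadicPrimesKummerThirdY07OddStubIneqs1`: `ineqs1_of_gainLines` over p1-g8's `hgainK0/O/K_sched1b` and p5's `hgainH_sched1b`), then
`endSizing1b` + `recordOdd1_datum`; both through `recordSupplyAtR₃_of_pack` with the `Λ`-order line `ordLine_of_negBound`.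
[cite: Nesterenko2003, Prop 4.1, §5; shape only] -/
theorem Y07Odd_recordSupplyOddR : ∀ (p : ℕ) [Fact p.Prime] (n : ℕ), 2 ≤ n → p ≠ 2 →
    Summit.ABC.StewartYu.G3Setup.RecordSupplyOddR (fun m => ((2 : ℝ) ^ 100) ^ m) p n := by
  intro p _ n hn hp2 S V Vmax W hSn hv hkum hV hV1 hVm hWb hW hU
  have hp3 : 3 ≤ p := by
    have h2 := (Fact.out : p.Prime).two_le
    omega
  have hn2 : 2 ≤ S.n := by omega
  have hn1 : 1 ≤ S.n := by omega
  set P : Summit.ABC.StewartYu.PadicG3Par S.n := Summit.ABC.StewartYu.parOdd₂ p hp3 hn1 V Vmax W hV1 hVm hW with hP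
  have hPp : P.p = p := rfl
  have hPA : P.A = V := rfl
  have hPW : P.W = W := rfl
  have hK₀ : P.K₀ = p - 1 := rfl
  have hθ : P.θ₀ = 1 / 2 := rfl
  have hAmaxV : P.Amax ≤ Vmax := Summit.ABC.StewartYu.parOdd₂.Amax_le_Vmax p hp3 hn1 V Vmax W hV1 hVm hW
  have hAmaxPr : P.Amax ≤ 2 ^ S.n * ∏ j, V j := Summit.ABC.StewartYu.parOdd₂.Amax_le_prod p hp3 hn1 V Vmax W hV1 hVm hW
  have hNq : P.Nq = P.K := Summit.ABC.StewartYu.parOdd₂.Nq_eq_K p hp3 hn1 V Vmax W hV1 hVm hW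
  have hNq2 : 2 ≤ P.Nq := Summit.ABC.StewartYu.parOdd₂.two_le_Nq p hp3 hn1 V Vmax W hV1 hVm hW
  have hA1 : ∀ j, 1 ≤ P.A j := fun j => by rw [hPA]; exact hV1 j
  have hAmaxΩ : P.Amax ≤ 2 ^ S.n * P.Ω := by unfold Summit.ABC.StewartYu.PadicG3Par.Ω; rw [hPA]; exact hAmaxPr
  have hW0 : 0 ≤ P.W := by rw [hPW]; linarith
  have hK₀' : P.K₀ = P.p - 1 := by rw [hK₀, hPp]
  have hc100 : (256 : ℝ) ≤ (2 : ℝ) ^ 100 := by norm_num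
  obtain ⟨hne, hord⟩ := S.ordLine_of_negBound hp2 hn2 V Vmax W hV1 hVm hWb hW hc100 hU P hPp
  by_cases hm : P.m = 0
  · obtain ⟨b, hb, hpack⟩ := S.ineqPackR₃_schedVb_one hn2 V Vmax W hV hV1 hWb hU P hPp hPA hAmaxV hAmaxPr hPW hNq hK₀ hθ hm
    have hrec := Summit.ABC.StewartYu.PadicG3Par.recordOddV_datum P hm (by rw [hPp]; exact hp3) hK₀' hNq hθ hA1 hAmaxΩ hAmaxV hW0 p hc100
    obtain ⟨hXfin, hSfin, hD₀, hD⟩ := S.endSizingVb P hNq2 hb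
    exact S.recordSupplyAtR₃_of_pack (P.schedVb b) hn1 (fun m => ((2 : ℝ) ^ 100) ^ m) V Vmax W _ _ _ _ hne hord hpack hXfin hSfin hD₀ hD hrec
  · have hm1 : 1 ≤ P.m := by omega
    obtain ⟨b, hb, hpack⟩ := Summit.ABC.ABC.Cruxes.Y07Odd.SlabOdd.stub_ineqs1 p hp2 S hn2 V Vmax W hv hkum hV hV1 hVm hWb hW hU P hPp hPA hAmaxV hAmaxPr hPW hNq hK₀ hθ hm1
    have hrec := Summit.ABC.StewartYu.PadicG3Par.recordOdd1_datum P hn2 hNq hθ hA1 hAmaxΩ hAmaxV hW0 p hc100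
    obtain ⟨hXfin, hSfin, hD₀, hD⟩ := S.endSizing1b P hNq2 hb
    exact S.recordSupplyAtR₃_of_pack (P.sched1b b) hn1 (fun m => ((2 : ℝ) ^ 100) ^ m) V Vmax W _ _ _ _ hne hord hpack hXfin hSfin hD₀ hD hrec

/-- FORMER STUB `Y07Odd_frameOdd` (load-bearing, XL; lead p2-g4, line `gen3-slab-odd`) — DISCHARGED modulo `Y07Odd_recordSupplyOddR`:
THE ODD-`p` ANALYTIC FRAME `FrameOdd C p n` at every rank `n ≥ 2` and odd prime for `C m = (2^{100})^m` (`c₁ = 2^{100}`, `C 1 ≥ 2`) is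
`G3Setup.frameOdd_of_recordR` (`PadicG3FrameOddR`, restricted Siegel count: pivot + `ofData` (Teichmüller twist) + START (slab pigeonhole + Siegel,
`PadicG3Start`) + the schedule induction `levels` (k-steps `PadicG3KStep*`/`LevelsI`, Kummer half-steps `PadicG3Half*`/`LevelStepH`) +
OUTPUT (`PadicG3Output` → `FrameOutputTwo`)) applied to the record's supply. [cite: Nesterenko2003, Prop 4.1, §5; shape only] -/
theorem Y07Odd_frameOdd :
    ∃ (C : ℕ → ℝ) (c₁ : ℝ), 1 ≤ c₁ ∧ (∀ m, 0 ≤ C m ∧ C m ≤ c₁ ^ m) ∧ 2 ≤ C 1 ∧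
      (Nesterenko2003_prop51 → ∀ p : ℕ, p.Prime → p ≠ 2 → ∀ n, 2 ≤ n →
        Summit.ABC.StewartYu.GenThreeFrameSpecOdd.FrameOdd C p n) := by
  refine ⟨fun m => ((2 : ℝ) ^ 100) ^ m, (2 : ℝ) ^ 100, by norm_num, fun m => ⟨by positivity, le_rfl⟩, by norm_num, ?_⟩
  intro _ p hp hp2 n hn
  haveI : Fact p.Prime := ⟨hp⟩
  exact Summit.ABC.StewartYu.G3Setup.frameOdd_of_recordR (by omega) hp2 (Y07Odd_recordSupplyOddR p n hn hp2)

/-- **CRUX `Y07Odd` OF ROUTE `PadicPrimesKummerThird`** — Yu's 2007 `p`-adic bound over `ℚ` for sets of primes at an odd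
prime `p ∉ S`, in the kernel: frame (`Y07Odd_frameOdd`) → Gen-3 engine at odd `p` (Matveev induction on the rank at the zero
estimate `Nesterenko2003_prop51_holds`, base ranks `GenThreeBaseOdd`) → the crux text (`αⱼ = qⱼ`, `c₆ = 3c₁`).
[cite: Yu2007, Main Thm (K = ℚ)] -/
theorem Y07Odd_proof : Y07Odd := by
  obtain ⟨C, c₁, hc₁, hC, hC1, hF⟩ := Y07Odd_frameOdd
  exact Summit.ABC.StewartYu.YuOhSeven.y07Odd_of_genThreeEngineOdd
    (Summit.ABC.StewartYu.GenThreeBaseOdd.engineOdd_of_frame_two_le hc₁ hC hC1 hF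
      Nesterenko2003_prop51_holds)

end Summit.ABC.ABC.Theorems
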